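import Summits.QuantumFields.BalabanUV.T4Continuum.Support.ShellMeasurePlaquetteCubicBoundary

/-!
# `T4Continuum.ShellMeasurePlaquetteCubicLocatedDich` — REPAIR of F-ne7cleaf02g9-1, part 2: row S77 file 1's located
# quadratic majorant of the η-scaled (39)-split action's gradient AT ONE BOND, re-concluded under the PER-BOND
# DICHOTOMY «full star in `Pl` OR weight `≤ L_b·η`» (two-sum form and kernel form, unified η-free stencil constant)
(cell `pub-balaban`, sub-cell `t4`, spine estimate NE7c (node U5b); NE7c ROUND-2 crew, unit
`b2b-balaban-t4-ne7c-formalise-leaf-02` gen 9; owner table `t4/b2b-balaban-t4-ne7c-p1/LEAVES-NE7c-P1.md` rows S65∕S77;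
FINDING F-ne7cleaf02g9-1 (journal l.18166, GAPS l.27205, kernel `ShellMeasurePlaquetteStarClosure` p228731);
ADDITIVE — imports part 1 `ShellMeasurePlaquetteCubicBoundary` ONLY; [folklore]; 0 `def`, 0 `def … : Prop`, 0 sorry,
0 citation tags)

HONEST FRAMING.  Finite four-torus programme, rung (B)+1 only — NOT infinite volume, NOT a mass gap, NOT the Clay
problem, NOT summit progress; (B), `BetaPertHyp`, (B^μ) are not consumed.  NE7c (`T4IndicatorShell.ShellWeightBound`)
is NOT PRINTED in [Balaban 1983–89] and NOT PROVED; «NE7c ⇐ the named binders» (trigger c3, WALL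
`t4/b2b-balaban-t4-ne7c-p1/WALL-NE7c-P1.md` §2b).  ELEMENTARY estimates for OUR typed action; [Balaban1985Variational]
(39)∕(97)–(98), p. 277 (1), p. 278 (5) LOCATE the shape only — the paper is under adjudication; nothing printed is
asserted or cited as a fact; no estimate of Bałaban's at a live level is discharged.  HONEST DEPENDENCY (cell):
continuum YM on T⁴ ⇐ BetaPertH ∧ nine spine estimates (0/9 proved); BetaPertH ⇐ (D1) ∧ (D4) ∧ CAP+tail; G-an2-4 gates
asym, D1 and NE2/3/4.

THE POINT.  S77 file 1's `located_quad_ord₃_eta_levels(_kernel)` (p226772) quantified the star hypothesis over ALL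
bonds and so (F-ne7cleaf02g9-1) spoke about `Λ = ∅`.  Here the SAME two conclusions are proved for ONE bond `c` from
the hypothesis for THAT bond in DICHOTOMY form — `plaqStar c ⊆ Pl` (summation by parts, S77 file 1 §2) OR
`wt c ≤ L_b·η` (naive, part 1 §2) — with the unified η-FREE stencil constant
`K∇ = (d−1)‖τ‖(72Lc³ + 48L_b·Lc²·((3d+2)d))` in place of `72(d−1)‖τ‖Lc³`, the `∇`-free part verbatim (S77 file 1 §1,
no star needed): `weighted_locGrad_cubT_le_located_dich`, **`located_quad_ord₃_eta_levels_dich`**,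
**`located_quad_ord₃_eta_levels_dich_kernel`**.  A box `Λ` with `Pl = {p : ∂p ⊆ Λ}` and level-0 weights on the bonds
whose star leaves the box INHABITS the dichotomy (witness in the sequel).  Nothing in the countdown moves; NE7c NOT
PROVED; spine PROVED 0∕9.
-/

noncomputable section

open scoped BigOperators

namespace Summit.QuantumFields.BalabanUV.T4Continuum.ShellMeasurePlaquetteCubicLocatedDich

open Literature.MathematicalPhysics.QuantumFieldTheory.Balaban1983to89
open B7Prop1Explicit (e U1 mem_U1)
open B8Ineq132 (covDerivFwd)
open ShellMeasureWilsonGradientTail (plaqWord bonds)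
open ShellMeasurePlaquetteTwist (plaqFunSym)
open ShellMeasureLocalGradientTailJet (ord₃)
open Summit.QuantumFields.BalabanUV.T4Continuum.ShellMeasureCommutatorVariation (plaqStar)
open Summit.QuantumFields.BalabanUV.T4Continuum.ShellMeasureCommutatorGradientLocal (baseSites nbhdSites)
open Summit.QuantumFields.BalabanUV.T4Continuum.ShellMeasureCommutatorLocGrad (ext cubT)
open Summit.QuantumFields.BalabanUV.T4Continuum.ShellMeasureLocalGradientTail (locGrad)
open Summit.QuantumFields.BalabanUV.T4Continuum.ShellMeasureMultiGridNorms
open Summit.QuantumFields.BalabanUV.T4Continuum.ShellMeasureMultiGridNormsMax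
open Summit.QuantumFields.BalabanUV.T4Continuum.ShellMeasurePlaquetteCubicDictionary (V0remCov)
open Summit.QuantumFields.BalabanUV.T4Continuum.ShellMeasurePlaquetteCubicCovBinders (analyticAt_V0remCov V0remCov_add_single)
open Summit.QuantumFields.BalabanUV.T4Continuum.ShellMeasureWilsonRemainderLevels (etaScale analyticAt_etaScale etaScale_add_single)
open Summit.QuantumFields.BalabanUV.T4Continuum.ShellMeasureWilsonRemainderLevelsCov (hcub_V0remCov_eta)
open Summit.QuantumFields.BalabanUV.T4Continuum.ShellMeasurePlaquetteCubicAssembly (restr_unit_bounded)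
open Summit.QuantumFields.BalabanUV.T4Continuum.ShellMeasurePlaquetteCubicAssemblyLevels (locGrad_etaScale_sum_ord₃_eq)
open Summit.QuantumFields.BalabanUV.T4Continuum.ShellMeasurePlaquetteCubicLocated
  (sum_filter_sum_eq_sum_card weighted_locGrad_le_located weighted_locGrad_cubT_le_located)
open Summit.QuantumFields.BalabanUV.T4Continuum.ShellMeasurePlaquetteCubicBoundary (weighted_locGrad_cubT_le_located_low)

export B7Prop1Explicit (Site)

variable {d : ℕ}

/-! ## Row S77's located quadratic majorant at ONE bond under the PER-BOND DICHOTOMY -/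

section Levels

variable {𝔸 : Type*} [NormedRing 𝔸] [NormOneClass 𝔸] [NormedAlgebra ℂ 𝔸] [CompleteSpace 𝔸]
  (Λ : Finset (Site d × Fin d)) (Pl : Finset (Fin d × Fin d × Site d)) (τ : 𝔸 →L[ℂ] ℂ)
  {U₀ : Site d → Fin d → 𝔸ˣ} (h₀ : ∀ y κ, U₀ y κ ∈ U1 𝔸) (bd : Fin d × Fin d × Site d → (Fin 4 → ↥Λ × Bool))
  (wt : ↥Λ → ℝ) [hwt : Fact (∀ b, 0 < wt b)] {I : Type*} [Fintype I] (wd : I → ℝ) [hwd : Fact (∀ i, 0 < wd i)]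
  (Dv : (↥Λ → 𝔸) →L[ℂ] (I → 𝔸)) (Wf Wd : ↥Λ → ℝ) (W : Fin d × Fin d × Site d → ℝ)
include h₀

omit [CompleteSpace 𝔸] in
/-- **THE `∇`-PART UNDER THE DICHOTOMY** at a bond `c`: EITHER its full star lies in `Pl` (S77 file 1's
`weighted_locGrad_cubT_le_located`, summation by parts, `72(d−1)‖τ‖Lc³`) OR its weight is at the lowest scale
`wt c ≤ L_b·η` (§2, naive, `48(d−1)‖τ‖(L_b·Lc²·((3d+2)d) + Lc³)`); both are dominated by the unified η-free constant
`K∇ = (d−1)‖τ‖(72Lc³ + 48L_b·Lc²·((3d+2)d))`. [folklore] -/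
theorem weighted_locGrad_cubT_le_located_dich {η : ℝ} (hη : 0 < η) (htr : ∀ P Q : 𝔸, τ (P * Q) = τ (Q * P))
    (hincr : ∀ p ∈ Pl, p.1 < p.2.1) {c : ↥Λ} {Lc Lb : ℝ} (hLc : 1 ≤ Lc) (hLb : 0 ≤ Lb)
    (hst' : plaqStar c.1.1 c.1.2 ⊆ Pl ∨ wt c ≤ Lb * η) (hWd0 : 0 < Wd c)
    (hWf : ∀ b' : ↥Λ, b'.1.1 ∈ nbhdSites c.1.1 c.1.2 → Wf c ≤ wt b')
    (hcf : wt c ≤ Lc * Wf c) (hcd : wt c ≤ Lc * Wd c)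
    (hDv : ∀ (A : ↥Λ → 𝔸) (x : Site d) (κ' τ' : Fin d), x ∈ baseSites c.1.1 →
      Wd c ^ 2 * ‖covDerivFwd η U₀ κ' (fun z => ext Λ A z τ') x‖ ≤ ‖(WSup.toPiL wd 2).symm (Dv A)‖)
    (Y : WMax wt wd Dv) :
    wt c ^ 3 * ‖locGrad (cubT Λ Pl (Complex.I / 2) τ η U₀) (WMax.toPiL wt wd Dv Y) c‖ ≤
      ((d : ℝ) - 1) * ‖τ‖ * (72 * Lc ^ 3 + 48 * Lb * Lc ^ 2 * ((3 * d + 2) * d : ℕ)) * ‖Y‖ *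
        ∑ b ∈ Finset.univ.filter (fun b : ↥Λ => b.1.1 ∈ nbhdSites c.1.1 c.1.2), wt b * ‖Y b‖ := by
  have hd : 0 ≤ (d : ℝ) - 1 := by
    have : 1 ≤ d := Nat.succ_le_of_lt (Fin.pos c.1.2)
    have : (1 : ℝ) ≤ d := by exact_mod_cast this
    linarith
  have hLc0 : 0 ≤ Lc := zero_le_one.trans hLc
  have hY0 : 0 ≤ ‖Y‖ := norm_nonneg _
  have hA1 : ∀ b, wt b * ‖Y b‖ ≤ ‖Y‖ := fun b => by
    have h := WSup.norm_apply_le wt 1 (WMax.toWSupL wt wd Dv Y) b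
    rw [pow_one] at h
    exact h.trans (WMax.norm_wsup_le wt wd Dv Y)
  have hA2 : ‖(WSup.toPiL wd 2).symm (Dv (WMax.toPiL wt wd Dv Y))‖ ≤ ‖Y‖ := WMax.norm_deriv_le wt wd Dv Y
  set S := ∑ b ∈ Finset.univ.filter (fun b : ↥Λ => b.1.1 ∈ nbhdSites c.1.1 c.1.2), wt b * ‖Y b‖ with hS_def
  have hS0 : 0 ≤ S := Finset.sum_nonneg fun b _ => mul_nonneg (hwt.out b).le (norm_nonneg _)
  have hn0 : (0 : ℝ) ≤ ((3 * d + 2) * d : ℕ) := by positivity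
  rcases hst' with hst | hlow
  · -- full star: summation by parts (S77 file 1)
    have hgrad := weighted_locGrad_cubT_le_located Λ Pl (Complex.I / 2) wt wd Dv Wf Wd hη h₀ htr hincr hst hLc
      hWd0 hWf hcf hcd hDv (WMax.toPiL wt wd Dv Y)
    rw [ShellMeasurePlaquetteCubicAssemblyLevels.norm_I_div_two] at hgrad
    refine hgrad.trans ?_
    have hK : 0 ≤ 144 * ((d : ℝ) - 1) * (1 / 2) * ‖τ‖ * Lc ^ 3 := by positivity
    calc 144 * ((d : ℝ) - 1) * (1 / 2) * ‖τ‖ * Lc ^ 3 * ‖(WSup.toPiL wd 2).symm (Dv (WMax.toPiL wt wd Dv Y))‖ * S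
        ≤ 144 * ((d : ℝ) - 1) * (1 / 2) * ‖τ‖ * Lc ^ 3 * ‖Y‖ * S :=
          mul_le_mul_of_nonneg_right (mul_le_mul_of_nonneg_left hA2 hK) hS0
      _ = ((d : ℝ) - 1) * ‖τ‖ * (72 * Lc ^ 3) * ‖Y‖ * S := by ring
      _ ≤ ((d : ℝ) - 1) * ‖τ‖ * (72 * Lc ^ 3 + 48 * Lb * Lc ^ 2 * ((3 * d + 2) * d : ℕ)) * ‖Y‖ * S := by
          have : 72 * Lc ^ 3 ≤ 72 * Lc ^ 3 + 48 * Lb * Lc ^ 2 * ((3 * d + 2) * d : ℕ) := by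
            have : 0 ≤ 48 * Lb * Lc ^ 2 * ((3 * d + 2) * d : ℕ) := by positivity
            linarith
          gcongr
  · -- lowest scale: the naive bound (§2)
    have hgrad := weighted_locGrad_cubT_le_located_low Λ Pl (Complex.I / 2) (τ := τ) wt wd Dv Wf Wd hη h₀ hincr hLc
      hlow hWd0 hWf hcf hcd hDv (WMax.toPiL wt wd Dv Y) hA1
    rw [ShellMeasurePlaquetteCubicAssemblyLevels.norm_I_div_two] at hgrad
    refine hgrad.trans ?_
    have hK : 0 ≤ 96 * ((d : ℝ) - 1) * (1 / 2) * ‖τ‖ := by positivity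
    have hin : Lb * Lc ^ 2 * ((3 * d + 2) * d : ℕ) * ‖Y‖ + Lc ^ 3 * ‖(WSup.toPiL wd 2).symm (Dv (WMax.toPiL wt wd Dv Y))‖
        ≤ (Lb * Lc ^ 2 * ((3 * d + 2) * d : ℕ) + Lc ^ 3) * ‖Y‖ := by
      have h3 : Lc ^ 3 * ‖(WSup.toPiL wd 2).symm (Dv (WMax.toPiL wt wd Dv Y))‖ ≤ Lc ^ 3 * ‖Y‖ :=
        mul_le_mul_of_nonneg_left hA2 (pow_nonneg hLc0 3)
      linarith
    calc 96 * ((d : ℝ) - 1) * (1 / 2) * ‖τ‖ *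
          (Lb * Lc ^ 2 * ((3 * d + 2) * d : ℕ) * ‖Y‖ + Lc ^ 3 * ‖(WSup.toPiL wd 2).symm (Dv (WMax.toPiL wt wd Dv Y))‖) * S
        ≤ 96 * ((d : ℝ) - 1) * (1 / 2) * ‖τ‖ * ((Lb * Lc ^ 2 * ((3 * d + 2) * d : ℕ) + Lc ^ 3) * ‖Y‖) * S :=
          mul_le_mul_of_nonneg_right (mul_le_mul_of_nonneg_left hin hK) hS0
      _ = ((d : ℝ) - 1) * ‖τ‖ * (48 * Lc ^ 3 + 48 * Lb * Lc ^ 2 * ((3 * d + 2) * d : ℕ)) * ‖Y‖ * S := by ring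
      _ ≤ ((d : ℝ) - 1) * ‖τ‖ * (72 * Lc ^ 3 + 48 * Lb * Lc ^ 2 * ((3 * d + 2) * d : ℕ)) * ‖Y‖ * S := by
          have : 48 * Lc ^ 3 + 48 * Lb * Lc ^ 2 * ((3 * d + 2) * d : ℕ)
              ≤ 72 * Lc ^ 3 + 48 * Lb * Lc ^ 2 * ((3 * d + 2) * d : ℕ) := by
            have : 0 ≤ Lc ^ 3 := by positivity
            linarith
          gcongr

/-- **ROW S77's LOCATED QUADRATIC MAJORANT AT A BOND, REPAIRED (two-sum form).**  f5d-c's∕S77 file 1's hypotheses with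
the global star hypothesis REPLACED by the dichotomy for the bond `c` at hand — `plaqStar c ⊆ Pl ∨ wt c ≤ L_b·η`,
`0 ≤ L_b` — everything else verbatim (boundaries `bd p = ∂p` in `Λ` oriented `(+,+,−,−)`, weights∕floors∕scale jump,
∇-datum domination, `‖U₀(∂p) − 1‖ ≤ ε₀(η∕W p)²`, τ tracial, `0 < ε`, `4ε ≤ 1`); for `‖Y‖_WMax < ε∕2`:
`(wt c)³·‖locGrad (etaScale η (Σ_{p∈Pl} ord₃ plaqFunSym_p)) Y c‖ ≤
   ‖Y‖·(K∇·Σ_{b : b.1.1 ∈ nbhdSites c} wt b‖Y b‖ + 8κLc⁴·Σ_{p∈Pl, c∈∂p} Σ_{b∈∂p} wt b‖Y b‖)`,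
`K∇ = (d−1)‖τ‖(72Lc³ + 48L_b·Lc²·((3d+2)d))`, `κ = ‖τ‖(248∕3·ε₀ + 40∕3·ε)` — η-FREE.  [Balaban1985Variational] (97)∕(98)
TYPE in located form; nothing printed is asserted. [folklore] -/
theorem located_quad_ord₃_eta_levels_dich {η : ℝ} (hη : 0 < η) (htr : ∀ P Q : 𝔸, τ (P * Q) = τ (Q * P))
    (hincr : ∀ p ∈ Pl, p.1 < p.2.1) {Lc Lb : ℝ} (hLc : 1 ≤ Lc) (hLb : 0 ≤ Lb) {c : ↥Λ}
    (hst' : plaqStar c.1.1 c.1.2 ⊆ Pl ∨ wt c ≤ Lb * η)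
    (hbd : ∀ p ∈ Pl, ((bd p 0).1 : Site d × Fin d) = (p.2.2, p.1) ∧ ((bd p 1).1 : Site d × Fin d) = (p.2.2 + e p.1, p.2.1)
      ∧ ((bd p 2).1 : Site d × Fin d) = (p.2.2 + e p.2.1, p.1) ∧ ((bd p 3).1 : Site d × Fin d) = (p.2.2, p.2.1))
    (hor : ∀ p ∈ Pl, (bd p 0).2 = true ∧ (bd p 1).2 = true ∧ (bd p 2).2 = false ∧ (bd p 3).2 = false)
    (hWd0 : 0 < Wd c) (hWf : ∀ b' : ↥Λ, b'.1.1 ∈ nbhdSites c.1.1 c.1.2 → Wf c ≤ wt b')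
    (hcf : wt c ≤ Lc * Wf c) (hcd : wt c ≤ Lc * Wd c)
    (hDv : ∀ (A : ↥Λ → 𝔸) (x : Site d) (κ' τ' : Fin d), x ∈ baseSites c.1.1 →
      Wd c ^ 2 * ‖covDerivFwd η U₀ κ' (fun z => ext Λ A z τ') x‖ ≤ ‖(WSup.toPiL wd 2).symm (Dv A)‖)
    {ε ε₀ : ℝ} (hε : 0 < ε) (hε₀ : 0 ≤ ε₀) (hε4 : 4 * ε ≤ 1) (hηW : ∀ p ∈ Pl, η ≤ W p)
    (hWw : ∀ p ∈ Pl, ∀ b ∈ bonds (bd p), W p ≤ wt b) (hwW : ∀ p ∈ Pl, ∀ b ∈ bonds (bd p), wt b ≤ Lc * W p)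
    (hreg : ∀ p ∈ Pl, ‖(plaqWord (fun b : ↥Λ => U₀ b.1.1 b.1.2) (bd p) (0 : ↥Λ → 𝔸) : 𝔸) - 1‖ ≤ ε₀ * (η / W p) ^ 2)
    (Y : WMax wt wd Dv) (hY : ‖Y‖ < ε / 2) :
    wt c ^ 3 * ‖locGrad (etaScale η (fun A : ↥Λ → 𝔸 =>
          ∑ p ∈ Pl, ord₃ (plaqFunSym τ (fun b : ↥Λ => U₀ b.1.1 b.1.2) (bd p)) A)) (WMax.toPiL wt wd Dv Y) c‖ ≤
      ‖Y‖ * (((d : ℝ) - 1) * ‖τ‖ * (72 * Lc ^ 3 + 48 * Lb * Lc ^ 2 * ((3 * d + 2) * d : ℕ)) *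
          ∑ b ∈ Finset.univ.filter (fun b : ↥Λ => b.1.1 ∈ nbhdSites c.1.1 c.1.2), wt b * ‖Y b‖
        + 8 * (‖τ‖ * (248 / 3 * ε₀ + 40 / 3 * ε)) * Lc ^ 4 *
          ∑ p ∈ Pl.filter (fun p => c ∈ bonds (bd p)), ∑ b ∈ bonds (bd p), wt b * ‖Y b‖) := by
  obtain ⟨hU, hU'⟩ := restr_unit_bounded Λ h₀
  have hY0 : 0 ≤ ‖Y‖ := norm_nonneg _
  have hA1 : ∀ b, wt b * ‖Y b‖ ≤ ‖Y‖ := fun b => by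
    have h := WSup.norm_apply_le wt 1 (WMax.toWSupL wt wd Dv Y) b
    rw [pow_one] at h
    exact h.trans (WMax.norm_wsup_le wt wd Dv Y)
  -- split the gradient ((39): commutator part at the η-free weight `i∕2` + the `∇`-free part)
  rw [locGrad_etaScale_sum_ord₃_eq Λ Pl τ h₀ bd htr hη.ne' hbd, Pi.add_apply]
  have hgrad := weighted_locGrad_cubT_le_located_dich Λ Pl τ h₀ wt wd Dv Wf Wd hη htr hincr hLc hLb hst' hWd0 hWf
    hcf hcd hDv Y
  -- the `∇`-free part: S77 file 1 §1 FIRED on `φ p := etaScale η (V0remCov τ U (bd p))` (no star needed)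
  have hκ : 0 ≤ ‖τ‖ * (248 / 3 * ε₀ + 40 / 3 * ε) := by positivity
  have hWpos : ∀ p ∈ Pl, 0 < W p := fun p hp => hη.trans_le (hηW p hp)
  have hfree := weighted_locGrad_le_located Pl (fun p => etaScale η (V0remCov τ (fun b : ↥Λ => U₀ b.1.1 b.1.2) (bd p)))
    (fun p => bonds (bd p)) wt W hκ hLc (fun b => hwt.out b) hWpos hWw hwW
    (fun p _ => ((ShellMeasureWilsonRemainderLevels.analyticOnNhd_etaScale
      (analyticAt_V0remCov τ (bd p) hU hU') η _).differentiableOn))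
    (fun p hp => hcub_V0remCov_eta τ hU hU' (bd p) (hor p hp).1 (hor p hp).2.1 (hor p hp).2.2.1 (hor p hp).2.2.2 hη
      (hηW p hp) hε₀ (hreg p hp) hε4)
    (fun p _ A b hb X => etaScale_add_single (fun A b hb X => V0remCov_add_single τ (bd p) hU hU' A hb X) η A hb X)
    hY0 hA1 (by linarith) c
  have hwt3 : 0 ≤ wt c ^ 3 := pow_nonneg (hwt.out c).le 3
  calc wt c ^ 3 * ‖locGrad (cubT Λ Pl (Complex.I / 2) τ η U₀) (WMax.toPiL wt wd Dv Y) c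
        + locGrad (fun A => ∑ p ∈ Pl, etaScale η (V0remCov τ (fun b : ↥Λ => U₀ b.1.1 b.1.2) (bd p)) A)
          (WMax.toPiL wt wd Dv Y) c‖
      ≤ wt c ^ 3 * ‖locGrad (cubT Λ Pl (Complex.I / 2) τ η U₀) (WMax.toPiL wt wd Dv Y) c‖
        + wt c ^ 3 * ‖locGrad (fun A => ∑ p ∈ Pl, etaScale η (V0remCov τ (fun b : ↥Λ => U₀ b.1.1 b.1.2) (bd p)) A)
          (WMax.toPiL wt wd Dv Y) c‖ := by
        rw [← mul_add]
        exact mul_le_mul_of_nonneg_left (norm_add_le _ _) hwt3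
    _ ≤ ((d : ℝ) - 1) * ‖τ‖ * (72 * Lc ^ 3 + 48 * Lb * Lc ^ 2 * ((3 * d + 2) * d : ℕ)) * ‖Y‖ *
          ∑ b ∈ Finset.univ.filter (fun b : ↥Λ => b.1.1 ∈ nbhdSites c.1.1 c.1.2), wt b * ‖Y b‖
        + 8 * (‖τ‖ * (248 / 3 * ε₀ + 40 / 3 * ε)) * Lc ^ 4 * ‖Y‖ *
          ∑ p ∈ Pl.filter (fun p => c ∈ bonds (bd p)), ∑ b ∈ bonds (bd p), wt b * ‖Y b‖ := add_le_add hgrad hfree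
    _ = _ := by ring

/-- **THE KERNEL FORM, REPAIRED** (the shape the owner's S75 f2 `prop4Hyp_pinned_weighted` consumes).  Same hypotheses;
with the η-FREE located kernel `k c b = K∇·[b.1.1 ∈ nbhdSites c.1.1 c.1.2] + 8κLc⁴·#{p ∈ Pl : c ∈ bonds (bd p) ∧ b ∈ bonds (bd p)}`:
`(wt c)³·‖locGrad (etaScale η (Σ_p ord₃ plaqFunSym_p)) Y c‖ ≤ ‖Y‖·Σ_b k c b·(wt b·‖Y b‖)` on `‖Y‖ < ε∕2`. [folklore] -/
theorem located_quad_ord₃_eta_levels_dich_kernel {η : ℝ} (hη : 0 < η) (htr : ∀ P Q : 𝔸, τ (P * Q) = τ (Q * P))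
    (hincr : ∀ p ∈ Pl, p.1 < p.2.1) {Lc Lb : ℝ} (hLc : 1 ≤ Lc) (hLb : 0 ≤ Lb) {c : ↥Λ}
    (hst' : plaqStar c.1.1 c.1.2 ⊆ Pl ∨ wt c ≤ Lb * η)
    (hbd : ∀ p ∈ Pl, ((bd p 0).1 : Site d × Fin d) = (p.2.2, p.1) ∧ ((bd p 1).1 : Site d × Fin d) = (p.2.2 + e p.1, p.2.1)
      ∧ ((bd p 2).1 : Site d × Fin d) = (p.2.2 + e p.2.1, p.1) ∧ ((bd p 3).1 : Site d × Fin d) = (p.2.2, p.2.1))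
    (hor : ∀ p ∈ Pl, (bd p 0).2 = true ∧ (bd p 1).2 = true ∧ (bd p 2).2 = false ∧ (bd p 3).2 = false)
    (hWd0 : 0 < Wd c) (hWf : ∀ b' : ↥Λ, b'.1.1 ∈ nbhdSites c.1.1 c.1.2 → Wf c ≤ wt b')
    (hcf : wt c ≤ Lc * Wf c) (hcd : wt c ≤ Lc * Wd c)
    (hDv : ∀ (A : ↥Λ → 𝔸) (x : Site d) (κ' τ' : Fin d), x ∈ baseSites c.1.1 →
      Wd c ^ 2 * ‖covDerivFwd η U₀ κ' (fun z => ext Λ A z τ') x‖ ≤ ‖(WSup.toPiL wd 2).symm (Dv A)‖)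
    {ε ε₀ : ℝ} (hε : 0 < ε) (hε₀ : 0 ≤ ε₀) (hε4 : 4 * ε ≤ 1) (hηW : ∀ p ∈ Pl, η ≤ W p)
    (hWw : ∀ p ∈ Pl, ∀ b ∈ bonds (bd p), W p ≤ wt b) (hwW : ∀ p ∈ Pl, ∀ b ∈ bonds (bd p), wt b ≤ Lc * W p)
    (hreg : ∀ p ∈ Pl, ‖(plaqWord (fun b : ↥Λ => U₀ b.1.1 b.1.2) (bd p) (0 : ↥Λ → 𝔸) : 𝔸) - 1‖ ≤ ε₀ * (η / W p) ^ 2)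
    (Y : WMax wt wd Dv) (hY : ‖Y‖ < ε / 2) :
    wt c ^ 3 * ‖locGrad (etaScale η (fun A : ↥Λ → 𝔸 =>
          ∑ p ∈ Pl, ord₃ (plaqFunSym τ (fun b : ↥Λ => U₀ b.1.1 b.1.2) (bd p)) A)) (WMax.toPiL wt wd Dv Y) c‖ ≤
      ‖Y‖ * ∑ b : ↥Λ,
        (((d : ℝ) - 1) * ‖τ‖ * (72 * Lc ^ 3 + 48 * Lb * Lc ^ 2 * ((3 * d + 2) * d : ℕ)) *
            (if b.1.1 ∈ nbhdSites c.1.1 c.1.2 then 1 else 0)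
          + 8 * (‖τ‖ * (248 / 3 * ε₀ + 40 / 3 * ε)) * Lc ^ 4 *
            ((Pl.filter (fun p => c ∈ bonds (bd p) ∧ b ∈ bonds (bd p))).card : ℝ)) * (wt b * ‖Y b‖) := by
  have h := located_quad_ord₃_eta_levels_dich Λ Pl τ h₀ bd wt wd Dv Wf Wd W hη htr hincr hLc hLb hst' hbd hor hWd0
    hWf hcf hcd hDv hε hε₀ hε4 hηW hWw hwW hreg Y hY
  refine h.trans (le_of_eq ?_)
  congr 1
  rw [sum_filter_sum_eq_sum_card Pl (fun p => bonds (bd p)) c (fun b => wt b * ‖Y b‖), Finset.sum_filter,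
    Finset.mul_sum, Finset.mul_sum, ← Finset.sum_add_distrib]
  refine Finset.sum_congr rfl fun b _ => ?_
  split_ifs <;> ring

end Levels

end Summit.QuantumFields.BalabanUV.T4Continuum.ShellMeasurePlaquetteCubicLocatedDich

end
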